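import Summits.QuantumFields.GaugeBoot.DiagonalRPTorusWordScript
import Summits.QuantumFields.GaugeBoot.DiagonalRPTorusHexCert
import HarnessLib

/-!
# The strong-coupling diagrams of the bent-hexagon pair: kernel-checked scripts (gauge-boot, L3 `d = 3` uniform window, J2 brick 6)

HONEST FRAMING (cell `pub-gaugeboot`, page 1 of every file): the venture produces certified bounds
on lattice expectations at stated coupling, gauge group, dimension and torus size; NOT a mass gap,
NOT a continuum limit, NOT a string tension; NOT Yang–Mills-summit-bearing (barriers
`FixedCouplingUltralocality`, `PerturbativeInvisibility`). This module is a KERNEL-CHECKED FINITE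
CERTIFICATE for a structural NEGATIVE result (a coupling window UNIFORM in the torus size for the
failure of inner-half diagonal reflection positivity on `(ℤ/L)^3`, plan note
`HOME/pub-gaugeboot-lean3/gen46/D3-UNIFORM-PLAN.md` §3 item 6c (J2)); it discharges nothing by
itself.

## Content (local chart at the base `y'` of the lower hexagon; data of `DiagonalRPTorusHexCert`)

The twelve faces of the closed surface "annulus ∪ two hexagons" as based lattice words:
`hexW` (the bent hexagon `γ_{y'}`, reading `LE₂`), `thexW` (the mirror-image hexagon at
`y' + 2e₀`, reading `LE₁`), `wordsOf tubeT` (the ten annulus plaquettes as plaquette words).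

* ★★ **`runOps_annulus`** — a 42-step gluing script (11 glues, 1 empty word; found outside Lean,
  `HOME/pub-gaugeboot-lean3/gen47/tools/j2_script.py`) CHECKS:
  `runOps 4 annulusScript (fWord :: gWord :: wordsOf tubeT) = some (11, 1)`, i.e. (brick 3)
  `E[Re χ(W_{θγ}) Re χ(W_{γ'}) ∏_{q ∈ annulus} Re χ(U_q)] = c₁^{11} · N` under (R1) — a sphere with
  twelve faces.
* ★ **`hasLonely_f`, `hasLonely_g`, `hasLonely_fg`** — EVERY proper sub-diagram has a lonely
  link: for all sublists `S` of the annulus, `{θγ} ∪ S` and `{γ'} ∪ S` have one, and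
  `{θγ, γ'} ∪ S` has one unless `S` is the whole annulus (`decide` over the `2^{10}` sublists);
  by brick 3 these diagrams VANISH under the centre twist.

Standard axioms only (`decide +kernel`); the torus consequences are brick 7.
-/

namespace Summit.QuantumFields.GaugeBoot

namespace DiagRPHex

/-- The bent hexagon `γ_y = ∂[(y;1,2) ∪ (y+e₁;0,2)]` as a closed word from `y`:
`y → y+e₂ → y+e₂+e₁ → y+e₀+e₁+e₂ → y+e₀+e₁ → y+e₁ → y`. -/
def hexW : Word 3 := [.fwd 2, .fwd 1, .fwd 0, .bwd 2, .bwd 0, .bwd 1]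

/-- The mirror image (axes `0 ↔ 1`) of `hexW`: the word of `θγ`. -/
def thexW : Word 3 := [.fwd 2, .fwd 0, .fwd 1, .bwd 2, .bwd 1, .bwd 0]

/-- The plaquette word of a plane code. -/
def pword (t : Fin 3) : Word 3 := Word.plaquette (pm t) (pn t)

/-- Local plaquettes as based plaquette words. -/
def wordsOf (S : List LPlaq) : List (LSite × Word 3) := S.map fun p => (p.1, pword p.2)

/-- The word of `f = Re χ(W_{θγ})`, based at `(2,0,0)` (`= θy₀ = y' + 2e₀`). -/
def fWord : LSite × Word 3 := ((2, 0, 0), thexW)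

/-- The word of `g = Re χ(W_{γ'})`, based at the origin of the chart. -/
def gWord : LSite × Word 3 := ((0, 0, 0), hexW)

/-- The gluing script for the twelve-face sphere (11 glues, 1 empty word). -/
def annulusScript : List GOp :=
  [.rev 9, .rev 9, .rev 3, .glue 4 0 3 0, .bt 0 2, .glue 1 0 3 0, .rot 0, .bt 0 6, .rev 5,
   .glue 1 0 5 0, .bt 0 4, .rot 0, .bt 0 4, .glue 0 1 0 0, .rev 4, .glue 1 0 5 0, .rot 0,
   .bt 0 6, .glue 0 1 0 0, .rev 3, .glue 1 0 9 0, .rot 0, .bt 0 10, .rot 0, .bt 0 8,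
   .glue 0 4 0 1, .rot 0, .bt 0 8, .glue 0 3 0 1, .rot 0, .bt 0 8, .rot 0, .bt 0 6,
   .glue 1 0 2 0, .bt 0 6, .rot 0, .bt 0 4, .glue 1 0 3 0, .bt 0 2, .bt 0 1, .bt 0 0, .nilw 0]

/-- ★★ **The annulus diagram glues to `c₁^{11} N`**: the script checks. -/
theorem runOps_annulus : runOps 4 annulusScript (fWord :: gWord :: wordsOf tubeT) = some (11, 1) := by
  decide +kernel

/-- The hexagon words read exactly the chart data `LE₂`, `LE₁`. -/
theorem ledges_hexW : ledges (0, 0, 0) hexW = LE₂ ∧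
    ledges (2, 0, 0) thexW = [((2, 0, 0), 2), ((2, 0, 1), 0), ((3, 0, 1), 1), ((3, 1, 0), 2),
      ((3, 0, 0), 1), ((2, 0, 0), 0)] := by
  constructor <;> decide +kernel

/-- `thexW` reads the links of `LE₁` (as a set). -/
theorem ledges_thexW_perm : (ledges (2, 0, 0) thexW).Perm LE₁ := by decide +kernel

/-- The hexagon words are closed. -/
theorem lendpoint_hexW : lendpoint (0, 0, 0) hexW = (0, 0, 0) ∧ lendpoint (2, 0, 0) thexW = (2, 0, 0) := by
  constructor <;> decide +kernel

/-- ★ Every sub-diagram `{θγ} ∪ S` has a lonely link. -/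
theorem hasLonely_f : ∀ S ∈ tubeT.sublists, hasLonely 4 (fWord :: wordsOf S) = true := by
  decide +kernel

/-- ★ Every sub-diagram `{γ'} ∪ S` has a lonely link. -/
theorem hasLonely_g : ∀ S ∈ tubeT.sublists, hasLonely 4 (gWord :: wordsOf S) = true := by
  decide +kernel

/-- ★ Every PROPER sub-diagram `{θγ, γ'} ∪ S`, `S ≠ annulus`, has a lonely link. -/
theorem hasLonely_fg : ∀ S ∈ tubeT.sublists, S ≠ tubeT → hasLonely 4 (fWord :: gWord :: wordsOf S) = true := by
  decide +kernel

/-- All links read by the twelve words lie in the box of radius `4`. -/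
theorem allInBox_faces : allInBox 4 (fWord :: gWord :: wordsOf tubeT) = true := by decide +kernel

end DiagRPHex

end Summit.QuantumFields.GaugeBoot
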